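import Summits.Ventures.MM22.Rank333.Root21CliqueCover
import HarnessLib

/-!
# MM22 venture — `R_{𝔽₂}(⟨3,3,3⟩) ≥ 21` from orbit bounds: the WEIGHTED clique-cover count (checker + soundness)

HONEST FRAMING (cell `pub-mm22`, seat bench g5; v4 item (0) «ROOT ⟸ 480», kernel form, variant without the lifted bound
`494 @ 20`). Checker PLUMBING with a soundness theorem, extending `Root21CliqueCover.lean`; it proves NO bound on `⟨3,3,3⟩`
by itself. The sibling data file (`Root21Of480LP.lean`: `rankGe21F2_of_480_lp`) is CONDITIONAL on twelve orbit bounds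
`Cert 3 3 3 K b` (one of them, orbit 480 at 19, OPEN). Nothing here proves `RankGe21F2`.

THE ARGUMENT. As in `Root21CliqueCover.lean`, a computation of `(X, Y) ↦ X Y` on `𝔽₂^{3×3} × 𝔽₂^{3×3}` with `r ≤ 20`
products, after discarding zero `X`-forms, has `r = 20` pairwise distinct, pairwise non-conflicting `X`-forms (each form
`x` has `Cert [x] 19`; conflicting pairs `f, g` have `Cert [f, g] 19`). Instead of covering the forms by `≤ 19` cliques,
this file double-counts against a WEIGHTED family of cliques `C_k` with weights `w_k`: if every form lies in cliques of
total weight `≥ D` (`covL`) then `20·D ≤ Σ_i cov(f_i) = Σ_k w_k · #{i : f_i ∈ C_k} ≤ Σ_k w_k` (a clique holds at most one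
of the forms), so `Σ_k w_k < 20·D` is a contradiction (`cert_nil_of_wchecks`): every computation has `≥ 21` products.
The data file uses the 14 cliques of rank ≤ 2 with weight 31 and the 168 left-translates `A·C₀` (`A ∈ GL₃(𝔽₂)`) of one
31-clique `C₀` of rank-3 forms with weight 1 (each rank-3 form lies in exactly 31 of them): `14·31 + 168 = 602 < 620`.

References: as in `Root21CliqueCover.lean` (Wang 2026 Lemma 1 / Lemma 3; the tree's `GF2OrbitSweep.lean`,
`GF2FastTable.lean`, `SubstitutionBacktracking.lean`, `ConstrainedMatMulSandwich.lean`).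
-/

namespace Summit.Ventures.MM22.GF2Cert.Root21

open Module Matrix Literature.Computability.AlgebraicComplexity
open Summit.MatrixMultiplication.OmegaCensus.GF2RankLB Summit.Ventures.MM22.GF2Cert Summit.Ventures.MM22

/-! ## Weighted coverage -/

/-- Total weight of the parts containing the form `x` (parts and weights aligned; missing weights count `0`). -/
def covL : List (List ℕ) → List ℕ → ℕ → ℕ
  | C :: Cs, w :: ws, x => (if C.contains x then w else 0) + covL Cs ws x
  | _, _, _ => 0

/-- Total weight of the (weighted) parts. -/
def wsum : List (List ℕ) → List ℕ → ℕ
  | _ :: Cs, w :: ws => w + wsum Cs ws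
  | _, _ => 0

/-- Weighted singles check, aligned with a list of forms: form `x` gets `Cert [x] b` with `b ≥ 19`, and either `b ≥ 20`
(the form can carry no product) or the parts containing `x` have total weight `≥ D`. -/
def wsinglesOK (reps : Reps) (parts : List (List ℕ)) (wts : List ℕ) (D : ℕ) : List ℕ → List (ℕ × Wit) → Bool
  | [], _ => true
  | _ :: _, [] => false
  | x :: xs, e :: es => Nat.ble 19 e.1 && witOK reps [x] e.1 e.2 &&
      (Nat.ble 20 e.1 || Nat.ble D (covL parts wts x)) && wsinglesOK reps parts wts D xs es

/-- The weighted singles check certifies every listed form at 19, and at 20 unless its coverage is `≥ D`. -/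
theorem single_of_wsinglesOK {reps : Reps} (hr : Hyps reps) {parts : List (List ℕ)} {wts : List ℕ} {D : ℕ} :
    ∀ {xs : List ℕ} {es : List (ℕ × Wit)}, wsinglesOK reps parts wts D xs es = true →
      ∀ x ∈ xs, Cert 3 3 3 [x] 19 ∧ (Cert 3 3 3 [x] 20 ∨ D ≤ covL parts wts x)
  | [], _, _, x, hx => absurd hx List.not_mem_nil
  | _ :: _, [], h, _, _ => by simp [wsinglesOK] at h
  | x :: xs, e :: es, h, y, hy => by
    simp only [wsinglesOK, Bool.and_eq_true, Bool.or_eq_true, Nat.ble_eq] at h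
    obtain ⟨⟨⟨h19, hw⟩, hor⟩, hrest⟩ := h
    rcases List.mem_cons.1 hy with rfl | hy
    · have hc := cert_of_witOK hr hw
      exact ⟨cert_mono h19 hc, hor.imp (fun h20 => cert_mono h20 hc) id⟩
    · exact single_of_wsinglesOK hr hrest y hy

/-- Chunking the weighted singles check: aligned concatenations. -/
theorem wsinglesOK_append {reps : Reps} {parts : List (List ℕ)} {wts : List ℕ} {D : ℕ} :
    ∀ {xs₁ : List ℕ} {es₁ : List (ℕ × Wit)} {xs₂ : List ℕ} {es₂ : List (ℕ × Wit)},
      xs₁.length = es₁.length → wsinglesOK reps parts wts D xs₁ es₁ = true →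
      wsinglesOK reps parts wts D xs₂ es₂ = true → wsinglesOK reps parts wts D (xs₁ ++ xs₂) (es₁ ++ es₂) = true
  | [], [], _, _, _, _, h2 => by simpa using h2
  | [], _ :: _, _, _, hl, _, _ => by simp at hl
  | _ :: _, [], _, _, hl, _, _ => by simp at hl
  | x :: xs, e :: es, xs₂, es₂, hl, h1, h2 => by
    simp only [wsinglesOK, Bool.and_eq_true] at h1
    simp only [List.cons_append, wsinglesOK, Bool.and_eq_true]
    exact ⟨h1.1, wsinglesOK_append (by simpa using hl) h1.2 h2⟩

/-- **Double counting**: if every part holds at most one of the values `c i`, the total coverage of the values is at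
most the total weight. -/
theorem sum_covL_le {r : ℕ} (c : Fin r → ℕ) :
    ∀ (parts : List (List ℕ)) (wts : List ℕ),
      (∀ k < parts.length, ∀ i j, c i ∈ parts.getD k [] → c j ∈ parts.getD k [] → i = j) →
      (∑ i, covL parts wts (c i)) ≤ wsum parts wts
  | [], wts, _ => by cases wts <;> simp [covL, wsum]
  | C :: Cs, [], _ => by simp [covL, wsum]
  | C :: Cs, w :: ws, h => by
    simp only [covL, wsum, Finset.sum_add_distrib]
    have h0 : ∀ i j, c i ∈ C → c j ∈ C → i = j := fun i j hi hj => h 0 (by simp) i j (by simpa using hi) (by simpa using hj)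
    have hrest : ∀ k < Cs.length, ∀ i j, c i ∈ Cs.getD k [] → c j ∈ Cs.getD k [] → i = j :=
      fun k hk i j hi hj => h (k + 1) (by simpa using hk) i j (by simpa using hi) (by simpa using hj)
    have ih := sum_covL_le c Cs ws hrest
    have h1 : (∑ i, if C.contains (c i) then w else 0) ≤ w := by
      rw [← Finset.sum_filter]
      rw [Finset.sum_const, smul_eq_mul]
      have hcard : (Finset.univ.filter fun i => C.contains (c i) = true).card ≤ 1 := by
        refine Finset.card_le_one.2 fun i hi j hj => ?_
        simp only [Finset.mem_filter, Finset.mem_univ, true_and, List.contains_iff_mem] at hi hj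
        exact h0 i j hi hj
      calc (Finset.univ.filter fun i => C.contains (c i) = true).card * w ≤ 1 * w :=
            Nat.mul_le_mul_right _ hcard
        _ = w := one_mul w
    omega

/-- **Main soundness theorem (weighted form).** If the parts check and the weighted singles check pass and the total
weight is below `20·D`, every `𝔽₂`-bilinear computation of `(X, Y) ↦ X Y` on `3 × 3` matrices has at least 21 products. -/
theorem cert_nil_of_wchecks {reps : Reps} (hr : Hyps reps) {parts : List (List ℕ)} {js : List PartJ} {wts : List ℕ}
    {D : ℕ} {es : List (ℕ × Wit)} (hp : partsOKFrom reps parts 0 js = true)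
    (hs : wsinglesOK reps parts wts D allForms es = true) (hsum : wsum parts wts < 20 * D) : Cert 3 3 3 [] 21 := by
  classical
  intro r β
  obtain ⟨r', hr'r, β', c, hcmem, hcf⟩ := exists_normal β
  suffices h21 : 21 ≤ r' by omega
  by_contra hlt
  have hle : r' ≤ 20 := by omega
  have hsing := fun i => single_of_wsinglesOK hr hs (c i) (hcmem i)
  have hcl := isClique_of_partsOK hr hp
  -- one product forces 20
  obtain ⟨i₀, _⟩ := exists_f_ne_zero β' psiK_nil_ne_zero
  have h20 : 20 ≤ r' := by
    have := add_card_le_of_cert β' c hcf [c i₀] {i₀} (fun i hi => by simp [Finset.mem_singleton.1 hi])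
      (hsing i₀).1
    simp only [Finset.card_singleton] at this
    omega
  -- every form is covered with weight ≥ D (forms at 20 carry no product)
  have hcov : ∀ i, D ≤ covL parts wts (c i) := by
    intro i
    rcases (hsing i).2 with h | h
    · have := add_card_le_of_cert β' c hcf [c i] {i} (fun i' hi => by simp [Finset.mem_singleton.1 hi]) h
      simp only [Finset.card_singleton] at this
      omega
    · exact h
  -- a clique holds at most one product
  have hone : ∀ k < parts.length, ∀ i j, c i ∈ parts.getD k [] → c j ∈ parts.getD k [] → i = j := by
    intro k hk i j hci hcj
    by_contra hne
    have hC : IsClique (parts.getD k []) := hcl k hk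
    have hcard : ({i, j} : Finset (Fin r')).card = 2 := Finset.card_pair hne
    by_cases hcc : c i = c j
    · have := add_card_le_of_cert β' c hcf [c i] {i, j}
        (fun i' hi => by
          simp only [Finset.mem_insert, Finset.mem_singleton] at hi
          rcases hi with rfl | rfl
          · exact List.mem_cons_self
          · rw [← hcc]; exact List.mem_cons_self)
        (hsing i).1
      rw [hcard] at this
      omega
    · obtain ⟨K', hiK, hjK, hK⟩ := hC (c i) hci (c j) hcj hcc
      have := add_card_le_of_cert β' c hcf K' {i, j}
        (fun i' hi => by
          simp only [Finset.mem_insert, Finset.mem_singleton] at hi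
          rcases hi with rfl | rfl
          · exact hiK
          · exact hjK)
        hK
      rw [hcard] at this
      omega
  -- double counting
  have hup := sum_covL_le c parts wts hone
  have hlow : r' * D ≤ ∑ i, covL parts wts (c i) := by
    have : (∑ _i : Fin r', D) ≤ ∑ i, covL parts wts (c i) := Finset.sum_le_sum fun i _ => hcov i
    simpa using this
  have : 20 * D ≤ r' * D := Nat.mul_le_mul_right _ h20
  omega

/-- **Reading off the rank bound** (weighted form): `21 ≤ R_{𝔽₂}(⟨3,3,3⟩)` under the hypothesis orbit bounds. -/
theorem rankGe21F2_of_wchecks {reps : Reps} (hr : Hyps reps) {parts : List (List ℕ)} {js : List PartJ} {wts : List ℕ}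
    {D : ℕ} {es : List (ℕ × Wit)} (hp : partsOKFrom reps parts 0 js = true)
    (hs : wsinglesOK reps parts wts D allForms es = true) (hsum : wsum parts wts < 20 * D) : RankGe21F2 := by
  unfold RankGe21F2
  exact le_tensorRank_matMulTensor_of_forall_constrained (subOf 3 3 []) (cert_nil_of_wchecks hr hp hs hsum)

end Summit.Ventures.MM22.GF2Cert.Root21
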